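import Summits.QuantumFields.YangMills.Theorems.BalabanUVNodesN12Prop1DirectOfClassOnlyRowL1
import Summits.QuantumFields.YangMills.Theorems.BalabanUVNodesN12WindowGaugeLetterUniformSocket
import Literature.MathematicalPhysics.QuantumFieldTheory.Balaban1983to89.B15Prop1PlaquetteLettersOfClass

/-!
# BalabanUVNodes ∕ N12 — (E1)⁶ `(x)_direct`: (D1)⁵ (NO small-below letter; (μ) row in PER-ROW ℓ¹ CURRENCY; NO torus bond count in the threshold) WITH EVERY LETTER UNDER THE THRESHOLD DISCHARGED BY
# NAME FROM THE (2.12) CLASS — the window gauge letter (σ)_W by dag-n12-w6 g7's `k`-UNIFORM window-LOCAL producer `N12WindowGaugeLetterUniformSocket.hσW_on_uniform_of_class`, the plaquette letter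
# `hPχ` and the tower-box plaquette letter `hPbox` by dag-n12-c g21's `B15Prop1PlaquetteLettersOfClass.hPχ_on_of_class` ∕ `hPbox_on_of_class` — GENERAL `Z`, no `∃ δ₀`, a floor INDEPENDENT of `k`

Cell `pub-ymgap` (HUMAN RULINGS D-0062 ∕ D-0149), seat `pub-ymgap-dag-n12-d` g21 (R134 N12 [B15] s2; the lane's v10 recipe INBOX l.44281 as AMENDED by INTENT-3 l.44505 (ρ6b `hrow`) and INTENT-2
l.44402 (ρ7)).  Count-neutral helper of K1⁹ `stmt-QuantumFields-27364` (`--kind proof --supports … --as helper`).  THEOREMS ONLY (0 `def`, 0 `instance`, 0 `sorry`); composition BY NAME of this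
seat's (D1)⁵ `N12Prop1DirectOfClassOnlyRowL1.…_ofWindowGaugeLetter_ofClassOnlyRowL1_explicit` ((P2c)‴ ρ6b chart half + (P4)′ proxies edition in per-row currency + (P5) by ρ7 with the closed-form
local count), dag-n12-w6 g7's `N12WindowGaugeLetterUniformSocket.hσW_on_uniform_of_class` (p675589) and dag-n12-c g21's `B15Prop1PlaquetteLettersOfClass.hPχ_on_of_class` ∕ `hPbox_on_of_class`
(p675521) — the same three producers (E1)⁵ (p681826) composes, at the same floor.

WHAT.  (E1)⁵'s statement VERBATIM except the v10 re-key inherited from (D1)⁵: (a) `hhalf i` is ρ6b's ∀-body `exists_hWD_chartHalf_of_class_uniform_rowl1_family` at `k i` (right inverse `H` =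
surjectivity witness; PER-ROW ℓ¹ PREIMAGE LETTER at `B₁`; ℓ¹-curvature letter at `M₂`; (μ) constant `2(d−1)·εP·B₁·M₂`); (b) binders `(εH B₁ M₂ ρ6 : ι → ℝ) (hB1) (hM₂0)`; (c) the (P4)′ letter
family `hHrow` (p678596's premises; conclusion `∃ H, hHinv ∧ per-row ℓ¹ preimage letter at B₁ i`); (d) in `Θ i` the (μ)-term `2(d−1)·B₁ i·((Σ_{j ∈ range (k i+1)} (2d)^j : ℕ)·M₂ i)` — every
explicit count left in the threshold is a large-field-REGION count or the per-height local count, NONE is the torus volume.  Everything else — the producers' rows `c hkc hc hεreg hα3 hα2 haN X D₀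
hXΩ hfit hBox hWX hfeedsX`, the k-free floor `hfloor : (((4d+m′+3)²L²∕4) + m′·24(((d+2)L)²∕4))·εreg + m′·ρn i ≤ δ i` as the ONLY row under `∀ δ ≤ min Θ εH` — as in (E1)⁵.  So N12's
per-instance Prop-1 display on the DIRECT road (this edition): (J0′) `hMin`@eR · geometry `hΩw W hWbox X D₀ hXΩ hfit hBox hWX hfeedsX` · numerics `c hkc hc hεreg hα3 hα2 haN hM4 hερ hερ6 hγle
hk1` · chart half `C ρ Kτ ρτ ρ5`+`hhalf` (ρ6b) · (P4)′ `εH B₁`+`hHrow` · (P5)∕guard `ρ6 M₂`+`hsbU hcurv` · `h15T` · per `δ ≤ min Θ εH`: `hfloor` only.  The knit «12Q-DIRECT v10» keys on this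
file; v9 (p682012 ∕ p682015 on (E1)⁵, ℓ² currency with `√#PBond` in `Θ`) stands as the sibling edition of record until the plan's word.

HONEST FRAMING ∕ LOCATED.  ∃∕∀ bookkeeping by name; display-level change only; `B₁` per `(M₁, Z)` (today's inhabitant `√#bonds(Ω₁(Z))·B`, dag-n12-w6's LOCATED-B), the (K) row's
`√#bonds(Ω₁(Z_i))` and the torus plaquette count in `hcA`∕`hcJ′`∕the analyticity radius (census U2a ∕ U3 ∕ U4) stay as typed — the thresholds are NOT print's `ε₀(d, L, M)`; the floor's
`C(d,L)` is explicit but NOT print's per-level `O(1)`; nothing of Bałaban's asserted; count-neutral; N12 NOT discharged; K1⁹ NOT closed; counts unmoved; one finite 𝕋⁴ programme at fixed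
`ε = L^{-K}` — R4 closes only the conditional rung `BalabanLadder.UV`; no summit statement is proved here and NOT the Yang–Mills mass gap (Clay); nothing continuum ∕ ℝ⁴ ∕ OS.

References: [Balaban1989LargeFieldI] CMP 122 (1989) 175–202, (1.74) p.192, Prop. 1 (1.77)–(1.78) p.194, (1.79) p.195; [Balaban1989LargeFieldII] CMP 122 (1989) 355–392, p.357,
(1.7)–(1.9) p.358, (1.12)–(1.13) p.359; [Balaban1985Variational] CMP 102 (1985) 277–309, (2)–(4) p.278, Thm 1 (8) p.279, (16)–(18) p.280, (44)–(48) p.285, (83) p.290;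
[Balaban1985Averaging] CMP 98 (1985) 17–51, (5) p.18, Prop. 2 (52)–(53) p.26; [Balaban1988Convergent] CMP 119 (1988) 243–285, (2.2) p.255, (2.10)–(2.14) pp.256–257, (2.16) p.257.
-/

noncomputable section

open Set Finset Metric Filter
open scoped BigOperators Matrix RealInnerProductSpace Real InnerProductSpace Topology Matrix.Norms.L2Operator

namespace Summit.QuantumFields.YangMills.BalabanUVNodes.N12Prop1DirectOfClassOnlyRowL1WindowUniform

open Literature.MathematicalPhysics.QuantumFieldTheory.Balaban1983to89
open T4Continuum B15DeterminingSets GaugeField B16Sect1Backgrounds B15Prop1Carrier B8Eq17ClassAkV1 BlockAveraging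
open B15Prop1SliceTaylorCalculus
open B15Prop1ChartCalculusSU2 (E3)
open T4CubeChartGnomonic (SU2)
open B15Prop1ChartSU2 (su2Chart)
open B15Prop1SliceCoordinates (GaugeSlice ιA freeBonds)
open B15Prop1AnalyticExtClause (cplxVec anExt)
open T4AdjointCovarianceUnitary (lieSU)
open T4AxialGaugeSmallField (castSite boxPlaqs boxBonds)
open B6BondElimination (unitVec)
open B6TreeGaugePoincare (curl)
open B16Eq18Proof (box mem_box)
open B15Extension193 (extend)
open B15ShellGauge193 (shellGauge)
open B14.Eq213MaximalDomains (side)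
open B14.Eq213DetSet B14.Eq216Concrete B15Sect1Instances B15Eq177GaugeInvariance B15Eq177ValueInvariance B15Eq177ValueInvarianceCoDiv B16Sect1Wilson
open B14.Eq22Determines (blockIter IsBlockUnion)
open Literature.MathematicalPhysics.QuantumFieldTheory.BalabanImbrieJaffe1984to88.BIJ85Eq453GaugeField
open Node00 (expChart msChart constrCard)
open B15Eq112TorusCover (lift)
open B5Eq118OneStroke (iterBlockOf)
open ExpMeanLog (deltaSU)
open Summit.QuantumFields.YangMills.BalabanUVNodes.N12Prop1DirectOfClassOnlyRowL1 (exists_domain_prop1Printed_lfVarOn_std_su2_box_intrinsic_analytic_atZSeqCoPRecord_ofThm1TorusClass_ofMinimiserFamily_ofWindowGaugeLetter_ofClassOnlyRowL1_explicit)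
open Summit.QuantumFields.YangMills.BalabanUVNodes.N12WindowGaugeLetterUniformSocket (hσW_on_uniform_of_class)
open B15Prop1PlaquetteLettersOfClass (hPχ_on_of_class hPbox_on_of_class)
open Node00 (avOfRecord regMSCoPOfRecord coeField constrEnum)

variable {F : T4Family}
/-- ★★★ **(E1)⁶ `(x)_direct` — NO LETTER ABOUT THE MINIMISER UNDER THE THRESHOLD, (μ) ROW IN PER-ROW ℓ¹ CURRENCY, NO TORUS BOND COUNT IN `Θ`: (D1)⁵ with the window gauge letter (σ)_W,
the plaquette letter `hPχ` AND the tower-box plaquette letter `hPbox` all DISCHARGED BY NAME from the (2.12) class of the minimiser** (dag-n12-w6 g7's k-UNIFORM window-LOCAL producer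
`hσW_on_uniform_of_class` p675589; dag-n12-c g21's `hPχ_on_of_class` ∕ `hPbox_on_of_class` p675521 — general `Z`, NO letter off the window).  Statement = (D1)⁵'s with the k-uniform
producer's rows (`c hkc hc hεreg hα3 hα2 haN X D₀ hXΩ hfit hBox hWX hfeedsX`) as binders and, inside the EXPLICIT-threshold frame `∀ δ, 0 < δ ≤ min Θ εH` (whose (μ)-term is
`2(d−1)·B₁ i·((Σ_{j≤k i}(2d)^j)·M₂ i)`), the three letters REPLACED by ONE numeric row: the k-free floor `hfloor : C(d,L)·εreg + m′·ρn i ≤ δ i` (`εreg ≤ δ i` for the class letters follows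
from it since `C(d,L) ≥ 1`).  Proof: one call of (D1)⁵ with `hσW := hσW_on_uniform_of_class … hfloor hfloor`, `hPχ := hPχ_on_of_class …`, `hPbox := hPbox_on_of_class …` — (E1)⁵'s proof verbatim.
[cite: Balaban1989LargeFieldI, (1.74) p.192, Prop. 1 (1.77)–(1.78) p.194, (1.79) p.195; Balaban1989LargeFieldII, p.357, (1.7)–(1.9) p.358, (1.12)–(1.13) p.359; Balaban1985Variational, (2)–(4) p.278, Thm 1 (8) p.279, (16)–(18) p.280, (44)–(48) p.285, (83) p.290; Balaban1985Averaging, (5) p.18, Prop. 2 (52)–(53) p.26; Balaban1988Convergent, (2.2) p.255, (2.10)–(2.14) pp.256–257, (2.16) p.257] -/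
theorem exists_domain_prop1Printed_lfVarOn_std_su2_box_intrinsic_analytic_atZSeqCoPRecord_ofThm1TorusClass_ofMinimiserFamily_ofClassOnlyRowL1_ofWindowGaugeUniform_explicit
    (ν : Node00.Stage7Numerics) (Kt : ℕ) (hd3 : 3 ≤ (F.P Kt).d) (h0 : 0 < (F.P Kt).d) {ι : Type}
    (Z Λ : ι → Set (Site (F.P Kt) 0)) (k : ι → ℕ) (M : ι → ℝ) (hk0 : ∀ i, 0 < k i) (hk1 : ∀ i, k i + 1 ≤ (F.P Kt).m + (F.P Kt).K)
    (eR : ι → ℝ) (heR : ∀ i, 0 < eR i)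
    (T : ∀ i, Finset (PBond (F.P Kt) (k i)))
    (lo hi : ι → Fin (F.P Kt).d → ℤ) (n : ι → ℕ) (hn : ∀ i κ, hi i κ ≤ lo i κ + n i) (hN : ∀ i, n i + 2 < (F.P Kt).sitesPerDir (k i))
    (hbox : ∀ i, pts (k i) (Λ i) = (castSite '' Set.Icc (lo i) (hi i) : Set (Site (F.P Kt) (k i))))
    (hZ : ∀ i, (boxPlaqs (lo i - 1) (hi i + 1) : Set (Plaq (F.P Kt) (k i))) ⊆ plaqsInside (pts (k i) (Z i)))
    (hTG0 : ∀ i, T i = (box (fun κ => (hi i κ - lo i κ + 1).toNat) (lo i)).image fun x =>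
      (⟨castSite (x - unitVec ⟨0, h0⟩), ⟨0, h0⟩⟩ : PBond (F.P Kt) (k i)))
    (hN5 : ∀ i κ, ((hi i κ - lo i κ + 1).toNat : ℤ) + 5 < (F.P Kt).sitesPerDir (k i))
    (K : ι → ℕ) (hK1 : ∀ i, 1 ≤ K i) (hKn : ∀ i κ, (hi i κ - lo i κ + 1).toNat ≤ K i)
    (ext : ∀ i, GaugeField (F.P Kt) (k i) SU2 → GaugeField (F.P Kt) (k i) SU2)
    (hext : ∀ i Vk, ext i Vk = extend (pts (k i) (Λ i)) (shellGauge Vk (lo i) (hi i)) Vk)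
    (hlohi : ∀ i, lo i ≤ hi i)
    -- the REGION parallelepipeds of the normalisation and the datum tolerances
    (LO HI : ι → Fin (F.P Kt).d → ℤ) (hLO : ∀ i, LO i ≤ lo i - 1) (hHI : ∀ i, hi i + 1 ≤ HI i) (n' : ι → ℕ) (hn' : ∀ i κ, HI i κ ≤ LO i κ + n' i)
    (hn'N : ∀ i, n' i < (F.P Kt).sitesPerDir (k i)) (hR' : ∀ i, (boxPlaqs (LO i) (HI i) : Set (Plaq (F.P Kt) (k i))) ⊆ plaqsInside (pts (k i) (Z i)))
    (ρn : ι → ℝ)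
    (hρn : ∀ i, (((F.P Kt).d : ℝ) * n' i + 1) * ((((F.P Kt).d - 1 : ℕ) : ℝ) * n' i * ((12 * (F.P Kt).d * (n i + 2) ^ 2 + 1) * eR i)
      + 3 * (F.P Kt).d * (n i + 2) ^ 2 * eR i) ≤ ρn i)
    {γ cJ bx : ℝ} (hγ : 0 < γ) (hcJ : 0 ≤ cJ) (hbx : 0 ≤ bx)
    (hbxM : ∀ i, 12 * ((F.P Kt).d : ℝ) * ((n i : ℝ) + 2) ^ 2 ≤ bx * (M i) ^ 2)
    {R 𝓐₀ : ι → ℝ} (hM : ∀ i, 1 ≤ (M i)) (hR : ∀ i, 0 < R i) (h𝓐₀ : ∀ i, 0 ≤ 𝓐₀ i)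
    -- (J0′), R-EXPLICIT: per instance one radius and one bound for every base field of the strict guard
    (hMin : ∀ i Vk, PlaqSmallOn (plaqsInside (pts (k i) (Z i ∩ (Λ i)ᶜ))) (eR i) Vk →
      ∃ Ũ : VecField (F.P Kt) (k i) (EuclideanSpace ℂ (Fin 3)) × VecField (F.P Kt) (k i) (EuclideanSpace ℂ (Fin 3)) →
          PBond (F.P Kt) 0 → Matrix (Fin 2) (Fin 2) ℂ,
        (∀ b a c, DifferentiableOn ℂ (fun z => Ũ z b a c) (ball 0 (R i))) ∧
        (∀ z ∈ ball (0 : VecField (F.P Kt) (k i) (EuclideanSpace ℂ (Fin 3)) × VecField (F.P Kt) (k i) (EuclideanSpace ℂ (Fin 3))) (R i),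
          ∀ b a c, ‖Ũ z b a c‖ ≤ 𝓐₀ i) ∧
        ∀ p B' : VecField (F.P Kt) (k i) E3, ‖p‖ < R i → ‖B'‖ < R i → ∃ U' : GaugeField (F.P Kt) 0 SU2,
          (∀ b, Ũ (cplxVec p, cplxVec B') b = ((U' b : SU2) : Matrix (Fin 2) (Fin 2) ℂ)) ∧
            IsMinimizer (Node00.avOfRecord F 2 Kt) (Node00.regMSCoPOfRecord F 2 ν Kt (k i) (maxDomT ν.M₁ (Z i))) (Bj ν.M₁ (Z i) (k i))
              (avgFamily (Node00.avOfRecord F 2 Kt) (qsstarGIter0 (k i) (expMul su2Chart B' (ext i (expMul su2Chart p Vk))))) U')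
    -- dag-n12-w4's GEOMETRY letter of the chart file (the window box and its two shifts inside `Ω_k(Z)`)
    (hΩw : ∀ i, ∀ (ν' : Fin (F.P Kt).d), ∀ z ∈ box (fun κ => (hi i κ - lo i κ + 1).toNat + 3) (fun κ => lo i κ - 2),
      (castSite z : Site (F.P Kt) (k i)) ∈ pts (k i) (maxDomT ν.M₁ (Z i) (k i)) ∧
        (castSite z : Site (F.P Kt) (k i)).shift ⟨0, h0⟩ ∈ pts (k i) (maxDomT ν.M₁ (Z i) (k i)) ∧
        (castSite z : Site (F.P Kt) (k i)).shift ν' ∈ pts (k i) (maxDomT ν.M₁ (Z i) (k i)))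
    -- the WINDOW per instance, containing every plaquette whose source lies in the fine image of the enlarged window box (the chart half's `hW`)
    (W : ι → Finset (Plaq (F.P Kt) 0))
    (hWbox : ∀ i, ∀ q : Plaq (F.P Kt) 0, q.src ∈ ((box (fun κ => (F.P Kt).L ^ (k i) * ((hi i κ - lo i κ + 1).toNat + 3 + 1) - 1) (fun κ => ((F.P Kt).L : ℤ) ^ (k i) * (lo i κ - 2))).image
        (fun z => (castSite z : Site (F.P Kt) 0))) → q ∈ W i)
    -- dag-n12-w6 g7's k-UNIFORM WINDOW-LOCAL (σ)_W producer `N12WindowGaugeLetterUniformSocket.hσW_on_uniform_of_class` (general `Z`, no letter off the window, tolerance `C(d,L)·εreg + m′·ρn`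
    -- INDEPENDENT of `k`): its NUMERICS per instance (level guard `k + c ≤ m + K` with `4d + m′ + 3 < 2L^c`), the class threshold `εreg` positive and Prop. 2-small, the WINDOW `X i` within
    -- walk-distance `D₀ i` of `Ω_{k_i}(Z_i)` (`hXΩ`) with the collar fit `hfit`, the REGION-BOX ROW `hBox` and the two window rows `hWX hfeedsX`
    (c : ι → ℕ) (hkc : ∀ i, k i + c i ≤ (F.P Kt).m + (F.P Kt).K) (hc : ∀ i, 4 * (F.P Kt).d + (3 * ((F.P Kt).d * (((F.P Kt).L - 1) / 2)) + 5) + 3 < 2 * (F.P Kt).L ^ c i)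
    (hα3 : (143 * (((((F.P Kt).d + 4 : ℕ) : ℝ)) ^ 2 / 4) ^ 2) * (ν.εreg * (F.P Kt).L ^ 2) ≤ 1 / 3)
    (hα2 : 2 * (ν.εreg * (F.P Kt).L ^ 2) ≤ 2 * deltaSU (Fin 2) / ((((F.P Kt).d + 4) * (F.P Kt).L : ℕ) : ℝ) ^ 2)
    (haN : (((((F.P Kt).d + 2) * (F.P Kt).L : ℕ) : ℝ) ^ 2 / 4) * (2 * (ν.εreg * (F.P Kt).L ^ 2)) < deltaSU (Fin 2))
    (X : ι → Set (Site (F.P Kt) 0)) (D₀ : ι → ℕ)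
    (hXΩ : ∀ i, ∀ x ∈ X i, ∃ x₀ ∈ maxDomT ν.M₁ (Z i) (k i), ∃ w₀ : List (Letter (F.P Kt).d), w₀.length ≤ D₀ i ∧ walkEnd x₀ w₀ = x)
    (hfit : ∀ i, D₀ i + 3 * (∑ i' ∈ Finset.range (k i + 1), ((F.P Kt).d * (((F.P Kt).L ^ i' - 1) / 2) + 1)) + ((3 * ((F.P Kt).d * (((F.P Kt).L - 1) / 2)) + 5) + 5) * (F.P Kt).L ^ k i +
      (((F.P Kt).d + 4) * (F.P Kt).L + 2) * (∑ l ∈ Finset.Ico 0 (k i), (F.P Kt).L ^ l) + 4 ≤ (F.P Kt).L ^ (k i - 1) * ν.M₁)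
    (hBox : ∀ i, ∀ x ∈ X i, ∀ w : List (Letter (F.P Kt).d),
      w.length ≤ (∑ i' ∈ Finset.range (k i + 1), ((F.P Kt).d * (((F.P Kt).L ^ i' - 1) / 2) + 1)) + (3 * ((F.P Kt).d * (((F.P Kt).L - 1) / 2)) + 5) * (F.P Kt).L ^ k i + (F.P Kt).L ^ k i →
      ∀ μ : Fin (F.P Kt).d, (⟨blockIter (k i) (walkEnd x w), μ⟩ : PBond (F.P Kt) (k i)) ∈ (boxBonds (LO i) (HI i) : Set (PBond (F.P Kt) (k i))))
    (hWX : ∀ i, ∀ p ∈ W i, p.src ∈ X i ∧ p.src.shift p.μ ∈ X i ∧ p.src.shift p.ν ∈ X i ∧ (p.src.shift p.μ).shift p.ν ∈ X i ∧ (p.src.shift p.ν).shift p.μ ∈ X i)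
    (hfeedsX : ∀ i (ν' : Fin (F.P Kt).d), ∀ z ∈ box (fun κ => (hi i κ - lo i κ + 1).toNat + 3) (fun κ => lo i κ - 2), ∀ b₀ : PBond (F.P Kt) 0,
      (b₀ ∈ feeds (k i) (⟨(castSite z : Site (F.P Kt) (k i)), ⟨0, h0⟩⟩ : PBond (F.P Kt) (k i)) ∨
        b₀ ∈ feeds (k i) (⟨((castSite z : Site (F.P Kt) (k i))).shift ⟨0, h0⟩, ν'⟩ : PBond (F.P Kt) (k i)) ∨
        b₀ ∈ feeds (k i) (⟨((castSite z : Site (F.P Kt) (k i))).shift ν', ⟨0, h0⟩⟩ : PBond (F.P Kt) (k i)) ∨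
        b₀ ∈ feeds (k i) (⟨(castSite z : Site (F.P Kt) (k i)), ν'⟩ : PBond (F.P Kt) (k i))) → b₀.src ∈ X i ∧ b₀.tgt ∈ X i)
    -- THE CHART HALF, DISPLAYED, `hsb`-FREE AND IN PER-ROW ℓ¹ CURRENCY (LOCATED-FLOOR + LOCATED-HSB + census U2b): FIVE per-height constants as BINDERS and ONE letter = the ∀-body of
    -- dag-n12-c g22's ρ6b `N12DirectChartPackageOfClassRowL1Family.exists_hWD_chartHalf_of_class_uniform_rowl1_family` at height `k i` (the right inverse `H` witnesses surjectivity only;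
    -- its size enters through the PER-ROW ℓ¹ PREIMAGE LETTER at `B₁`, the curvature through the ℓ¹-curvature letter at `M₂`; (μ) constant `2(d−1)·εP·B₁·M₂` — NO torus bond count)
    (C ρ Kτ ρτ ρ5 : ι → ℝ) (hρ : ∀ i, 0 < ρ i) (hKτ : ∀ i, 0 ≤ Kτ i) (hρτ : ∀ i, 0 < ρτ i)
    (hhalf : ∀ i,
        ∀ (ν : Node00.Stage7Numerics) (Z Λ : Set (Site (F.P Kt) 0)) (T : Finset (PBond (F.P Kt) (k i))) (lo hi : Fin (F.P Kt).d → ℤ),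
        (∀ κ, ((((hi κ - lo κ + 1).toNat + 3 : ℕ) : ℤ)) ≤ (F.P Kt).sitesPerDir (k i)) →
        (∀ (ν' : Fin (F.P Kt).d), ∀ z ∈ box (fun κ => (hi κ - lo κ + 1).toNat + 3) (fun κ => lo κ - 2),
          (castSite z : Site (F.P Kt) (k i)) ∈ pts (k i) (maxDomT ν.M₁ Z (k i)) ∧ (castSite z : Site (F.P Kt) (k i)).shift ⟨0, h0⟩ ∈ pts (k i) (maxDomT ν.M₁ Z (k i)) ∧
            (castSite z : Site (F.P Kt) (k i)).shift ν' ∈ pts (k i) (maxDomT ν.M₁ Z (k i))) →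
        (k i) + 1 ≤ (F.P Kt).m + (F.P Kt).K → 4 * (F.P Kt).L ≤ ν.M₁ → side (F.P Kt).L ν.M₁ (k i) ∣ (F.P Kt).sitesPerDir 0 → 0 ≤ ν.εreg →
        6 * ((((F.P Kt).d - 1 : ℕ)) : ℝ) * (F.P Kt).L * ν.εreg ≤ ρ5 i →
        ∀ (ext : GaugeField (F.P Kt) (k i) SU2 → GaugeField (F.P Kt) (k i) SU2) (Vk : GaugeField (F.P Kt) (k i) SU2),
        ∀ (U₀ : GaugeField (F.P Kt) 0 SU2) (Xf : GaugeSlice (pts (k i) Λ) T E3 → PBond (F.P Kt) 0 → lieSU (Fin 2)),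
        IsMinimizer (Node00.avOfRecord F 2 Kt) (Node00.regMSCoPOfRecord F 2 ν Kt (k i) (maxDomT ν.M₁ Z)) (Bj ν.M₁ Z (k i))
          (avgFamily (Node00.avOfRecord F 2 Kt) (qsstarGIter0 (k i) (ext Vk))) U₀ →
        ∀ ⦃εP : ℝ⦄, 0 ≤ εP →
        (∀ p : Plaq (F.P Kt) 0, ((⟨p.src, p.μ⟩ : PBond (F.P Kt) 0) ∈ {b : PBond (F.P Kt) 0 | b.src ∈ maxDomT ν.M₁ Z 1} ∨
            (⟨p.src.shift p.μ, p.ν⟩ : PBond (F.P Kt) 0) ∈ {b : PBond (F.P Kt) 0 | b.src ∈ maxDomT ν.M₁ Z 1} ∨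
            (⟨p.src.shift p.ν, p.μ⟩ : PBond (F.P Kt) 0) ∈ {b : PBond (F.P Kt) 0 | b.src ∈ maxDomT ν.M₁ Z 1} ∨
            (⟨p.src, p.ν⟩ : PBond (F.P Kt) 0) ∈ {b : PBond (F.P Kt) 0 | b.src ∈ maxDomT ν.M₁ Z 1}) →
          ‖((GaugeField.plaqHol U₀ p : SU2) : Matrix (Fin 2) (Fin 2) ℂ) - 1‖ ≤ εP) →
        ∀ (H : (Fin (constrCard (Bj ν.M₁ Z (k i)) (k i)) → lieSU (Fin 2)) → PBond (F.P Kt) 0 → lieSU (Fin 2)),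
        (∀ v, fderiv ℝ (msChart F 2 Kt (k i) (Bj ν.M₁ Z (k i)) (avgFamily (avOfRecord F 2 Kt) (qsstarGIter0 (k i) (ext Vk))) U₀) 0 (H v) = v) →
        ∀ ⦃B₁ : ℝ⦄, 0 ≤ B₁ →
        (∀ i' : Fin (constrCard (Bj ν.M₁ Z (k i)) (k i)), 1 ≤ ((((constrEnum (Bj ν.M₁ Z (k i)) (k i)).symm i').1 : ℕ)) → ∀ ξ : lieSU (Fin 2),
          ∃ x : PBond (F.P Kt) 0 → lieSU (Fin 2), fderiv ℝ (msChart F 2 Kt (k i) (Bj ν.M₁ Z (k i)) (avgFamily (avOfRecord F 2 Kt) (qsstarGIter0 (k i) (ext Vk))) U₀) 0 x = Pi.single i' ξ ∧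
            ∑ b, ‖(x b : Matrix (Fin 2) (Fin 2) ℂ)‖ ≤ B₁ * ‖ξ‖) →
        ∀ ⦃M₂ : ℝ⦄, (∀ w, ∑ c, ‖fderiv ℝ (fderiv ℝ (msChart F 2 Kt (k i) (Bj ν.M₁ Z (k i)) (avgFamily (avOfRecord F 2 Kt) (qsstarGIter0 (k i) (ext Vk))) U₀)) 0 w w c‖ ≤ M₂ * ∑ b, ‖w b‖ ^ 2) →
        Xf 0 = 0 → ContDiffAt ℝ 2 Xf 0 →
        (∀ᶠ Y in 𝓝 (0 : GaugeSlice (pts (k i) Λ) T E3),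
          IsMinimizer (Node00.avOfRecord F 2 Kt) (Node00.regMSCoPOfRecord F 2 ν Kt (k i) (maxDomT ν.M₁ Z)) (Bj ν.M₁ Z (k i))
            (avgFamily (Node00.avOfRecord F 2 Kt) (qsstarGIter0 (k i) (expMul su2Chart (ιA (pts (k i) Λ) T Y) (ext Vk)))) (expChart U₀ (Xf Y))) →
        ∀ ⦃K₂ : ℝ⦄, (∀ X : GaugeSlice (pts (k i) Λ) T E3, Real.sqrt (∑ b, ‖fderiv ℝ Xf 0 X b‖ ^ 2) ≤ K₂ * ‖X‖) →
        ∀ (W : Finset (Plaq (F.P Kt) 0)),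
        (∀ q : Plaq (F.P Kt) 0, q.src ∈ ((box (fun κ => (F.P Kt).L ^ (k i) * ((hi κ - lo κ + 1).toNat + 3 + 1) - 1) (fun κ => ((F.P Kt).L : ℤ) ^ (k i) * (lo κ - 2))).image
            (fun z => (castSite z : Site (F.P Kt) 0))) → q ∈ W) →
        ∀ ⦃δW : ℝ⦄, 0 < δW → δW < ρ i → δW < ρτ i →
        (∀ (ν' : Fin (F.P Kt).d), ∀ z ∈ box (fun κ => (hi κ - lo κ + 1).toNat + 3) (fun κ => lo κ - 2), ∀ b₀ : PBond (F.P Kt) 0,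
          (b₀ ∈ feeds (k i) (⟨(castSite z : Site (F.P Kt) (k i)), ⟨0, h0⟩⟩ : PBond (F.P Kt) (k i)) ∨ b₀ ∈ feeds (k i) (⟨((castSite z : Site (F.P Kt) (k i))).shift ⟨0, h0⟩, ν'⟩ : PBond (F.P Kt) (k i))
          ∨ b₀ ∈ feeds (k i) (⟨((castSite z : Site (F.P Kt) (k i))).shift ν', ⟨0, h0⟩⟩ : PBond (F.P Kt) (k i)) ∨ b₀ ∈ feeds (k i) (⟨(castSite z : Site (F.P Kt) (k i)), ν'⟩ : PBond (F.P Kt) (k i))) →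
          ‖((U₀ b₀ : SU2) : Matrix (Fin 2) (Fin 2) ℂ) - 1‖ ≤ δW) →
        ∃ (Ψ₂ : (PBond (F.P Kt) 0 → lieSU (Fin 2)) →L[ℝ] (PBond (F.P Kt) 0 → lieSU (Fin 2)) →L[ℝ] (Fin (constrCard (Bj ν.M₁ Z (k i)) (k i)) → lieSU (Fin 2)))
          (lam : (Fin (constrCard (Bj ν.M₁ Z (k i)) (k i)) → lieSU (Fin 2)) →L[ℝ] ℝ)
          (p : Seminorm ℝ (PBond (F.P Kt) 0 → lieSU (Fin 2))),
          HasFDerivAt (fun Y => fderiv ℝ (msChart F 2 Kt (k i) (Bj ν.M₁ Z (k i)) (avgFamily (avOfRecord F 2 Kt) (qsstarGIter0 (k i) (ext Vk))) U₀) Y) Ψ₂ 0 ∧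
          (∀ᶠ Y in 𝓝 (0 : PBond (F.P Kt) 0 → lieSU (Fin 2)), DifferentiableAt ℝ (msChart F 2 Kt (k i) (Bj ν.M₁ Z (k i)) (avgFamily (avOfRecord F 2 Kt) (qsstarGIter0 (k i) (ext Vk))) U₀) Y) ∧
          fderiv ℝ (fun Y : PBond (F.P Kt) 0 → lieSU (Fin 2) => wilsonAction4 (expChart U₀ Y)) 0 = lam.comp (fderiv ℝ (msChart F 2 Kt (k i) (Bj ν.M₁ Z (k i)) (avgFamily (avOfRecord F 2 Kt) (qsstarGIter0 (k i) (ext Vk))) U₀) 0) ∧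
          (∀ Y : PBond (F.P Kt) 0 → lieSU (Fin 2), ∑ b, ‖(Y b : Matrix (Fin 2) (Fin 2) ℂ)‖ ^ 2 ≤ p Y ^ 2) ∧
          ∀ X : GaugeSlice (pts (k i) Λ) T E3,
            lam (Ψ₂ (fderiv ℝ Xf 0 X) (fderiv ℝ Xf 0 X))
                ≤ (2 * (((F.P Kt).d : ℝ) - 1) * εP * B₁ * M₂) * p (fderiv ℝ Xf 0 X) ^ 2 ∧
            p (fderiv ℝ Xf 0 X) ≤ K₂ * ‖X‖ ∧
            (((F.P Kt).L : ℝ) ^ (F.P Kt).d) ^ (k i) / ((((F.P Kt).L : ℝ)) ^ 2 * ((F.P Kt).L : ℝ) ^ 2) ^ (k i) / 2 * (∑ z ∈ box (fun κ => (hi κ - lo κ + 1).toNat + 3) (fun κ => lo κ - 2), ∑ μ : Fin (F.P Kt).d, ∑ a : Fin 3, curl (fun b => ιA (pts (k i) Λ) T X (⟨castSite b.1, b.2⟩ : PBond (F.P Kt) (k i)) a) z ⟨0, h0⟩ μ ^ 2)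
                - (((F.P Kt).L : ℝ) ^ (F.P Kt).d) ^ (k i) / ((((F.P Kt).L : ℝ)) ^ 2 * ((F.P Kt).L : ℝ) ^ 2) ^ (k i) * (8 * (((F.P Kt).d : ℝ) + 1) * (2 * ((Kτ i) + 1) * δW) + 8 * ((F.P Kt).d : ℝ) * (((box (fun κ => (hi κ - lo κ + 1).toNat + 3) (fun κ => lo κ - 2)).image (fun z => (castSite z : Site (F.P Kt) (k i)))).card : ℝ) * ((C i) * δW * K₂) ^ 2) * ‖X‖ ^ 2
              ≤ ((Fintype.card (Fin 2) : ℝ)⁻¹ • ∑ p ∈ W, (innerSL ℝ (E := lieSU (Fin 2))).bilinearComp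
                (ContinuousLinearMap.proj (R := ℝ) (φ := fun _ : PBond (F.P Kt) 0 => lieSU (Fin 2)) (⟨p.src, p.μ⟩ : PBond (F.P Kt) 0) + ContinuousLinearMap.proj (R := ℝ) (φ := fun _ : PBond (F.P Kt) 0 => lieSU (Fin 2)) (⟨p.src.shift p.μ, p.ν⟩ : PBond (F.P Kt) 0)
                  - ContinuousLinearMap.proj (R := ℝ) (φ := fun _ : PBond (F.P Kt) 0 => lieSU (Fin 2)) (⟨p.src.shift p.ν, p.μ⟩ : PBond (F.P Kt) 0) - ContinuousLinearMap.proj (R := ℝ) (φ := fun _ : PBond (F.P Kt) 0 => lieSU (Fin 2)) (⟨p.src, p.ν⟩ : PBond (F.P Kt) 0) : (PBond (F.P Kt) 0 → lieSU (Fin 2)) →L[ℝ] lieSU (Fin 2))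
                (ContinuousLinearMap.proj (R := ℝ) (φ := fun _ : PBond (F.P Kt) 0 => lieSU (Fin 2)) (⟨p.src, p.μ⟩ : PBond (F.P Kt) 0) + ContinuousLinearMap.proj (R := ℝ) (φ := fun _ : PBond (F.P Kt) 0 => lieSU (Fin 2)) (⟨p.src.shift p.μ, p.ν⟩ : PBond (F.P Kt) 0)
                  - ContinuousLinearMap.proj (R := ℝ) (φ := fun _ : PBond (F.P Kt) 0 => lieSU (Fin 2)) (⟨p.src.shift p.ν, p.μ⟩ : PBond (F.P Kt) 0) - ContinuousLinearMap.proj (R := ℝ) (φ := fun _ : PBond (F.P Kt) 0 => lieSU (Fin 2)) (⟨p.src, p.ν⟩ : PBond (F.P Kt) 0) : (PBond (F.P Kt) 0 → lieSU (Fin 2)) →L[ℝ] lieSU (Fin 2))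
                : (PBond (F.P Kt) 0 → lieSU (Fin 2)) →L[ℝ] (PBond (F.P Kt) 0 → lieSU (Fin 2)) →L[ℝ] ℝ) (fderiv ℝ Xf 0 X) (fderiv ℝ Xf 0 X))
    -- the `hsb`-free letter's numeric premises displayed: radius row, the class threshold positive, and its floor against the per-height curvature radius `ρ5`
    (hM4 : 4 * (F.P Kt).L ≤ ν.M₁) (hεreg : 0 < ν.εreg) (hερ : ∀ i, 6 * ((((F.P Kt).d - 1 : ℕ)) : ℝ) * (F.P Kt).L * ν.εreg ≤ ρ5 i)
    -- THE (P4)′ PRODUCER's TWO CONSTANTS, THE (P5) CONSTANT AND THE NEAR-FLAT GUARD RADIUS PER INSTANCE, AS BINDERS (`εH`, `ρ6`, `M₂` per height; `B₁` per `(M₁, Z)` — never after `εreg`∕`ρn`),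
    -- and THREE LETTERS displayed: `hHrow` = dag-n12-w6 g7's `N12DirectSurjHsurjProxies.exists_rightInverse_letter_of_proxies` (p678596) premises at `(2, Kt, k i, ν.M₁, Z i; εH i)` VERBATIM —
    -- NO `SmallBelow U₀`: its guarded PROXIES (per constrained bond, per inner site) are produced from the class below — concluding, in ρ6b's PER-ROW ℓ¹ CURRENCY, a right inverse `H`
    -- (surjectivity witness) AND the per-row ℓ¹ preimage letter at `B₁ i`; `hsbU` ∕ `hcurv` = the two conjuncts of dag-n12-w4's `Node00.exists_uniform_chartCurvature_sq_bound (k i)` at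
    -- `(ρ6 i, M₂ i)` (near-flat fields are guarded; uniform sup-curvature bound at the near-flat core) — ρ7 turns them into the ℓ¹-curvature bound with the local count `Σ_{j≤k i}(2d)^j`
    (εH B₁ M₂ ρ6 : ι → ℝ) (hB1 : ∀ i, 0 ≤ B₁ i) (hM₂0 : ∀ i, 0 ≤ M₂ i)
    (hHrow : ∀ i (Wd : MSField (F.P Kt) SU2) (U₀ : GaugeField (F.P Kt) 0 SU2),
      AgreeOn (Bj ν.M₁ (Z i) (k i)) (avgFamily (Node00.avOfRecord F 2 Kt) U₀) Wd →
      (∀ i' : Fin (constrCard (Bj ν.M₁ (Z i) (k i)) (k i)), ∃ U' : GaugeField (F.P Kt) 0 SU2,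
        (∀ b ∈ feeds (((constrEnum (Bj ν.M₁ (Z i) (k i)) (k i)).symm i').1 : ℕ) ((constrEnum (Bj ν.M₁ (Z i) (k i)) (k i)).symm i').2.1, U' b = U₀ b) ∧
          Node00.SmallBelow (Node00.avOfRecord F 2 Kt) (k i) U') →
      (∀ (j : ℕ), 1 ≤ j → j ≤ k i → ∀ y : Site (F.P Kt) j, embIter j y ∈ maxDomT ν.M₁ (Z i) j → ∃ U' : GaugeField (F.P Kt) 0 SU2,
        (∀ c : PBond (F.P Kt) j, (c.src = y ∨ c.tgt = y) → ∀ b₀ : PBond (F.P Kt) 0,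
          (iterBlockOf j b₀.src = c.src ∨ iterBlockOf j b₀.src = c.tgt) → (iterBlockOf j b₀.tgt = c.src ∨ iterBlockOf j b₀.tgt = c.tgt) → U' b₀ = U₀ b₀) ∧
        Node00.SmallBelow (Node00.avOfRecord F 2 Kt) (k i) U') →
      (∀ (j : ℕ), 1 ≤ j → j ≤ k i → ∀ y : Site (F.P Kt) j, embIter j y ∈ maxDomT ν.M₁ (Z i) j →
        PlaqSmallOn (boxPlaqs (fun κ => lift (F.P Kt) (embIter j y) κ - ((((F.P Kt).L ^ j : ℕ) : ℤ) + ((((F.P Kt).L ^ j - 1) / 2 : ℕ) : ℤ)))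
          (fun κ => lift (F.P Kt) (embIter j y) κ + ((((F.P Kt).L ^ j : ℕ) : ℤ) + ((((F.P Kt).L ^ j - 1) / 2 : ℕ) : ℤ))) : Set (Plaq (F.P Kt) 0)) (εH i) U₀) →
      ∃ H : (Fin (constrCard (Bj ν.M₁ (Z i) (k i)) (k i)) → lieSU (Fin 2)) → PBond (F.P Kt) 0 → lieSU (Fin 2),
        (∀ v, fderiv ℝ (msChart F 2 Kt (k i) (Bj ν.M₁ (Z i) (k i)) Wd U₀) 0 (H v) = v) ∧
        ∀ i' : Fin (constrCard (Bj ν.M₁ (Z i) (k i)) (k i)), 1 ≤ ((((constrEnum (Bj ν.M₁ (Z i) (k i)) (k i)).symm i').1 : ℕ)) → ∀ ξ : lieSU (Fin 2),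
          ∃ x : PBond (F.P Kt) 0 → lieSU (Fin 2), fderiv ℝ (msChart F 2 Kt (k i) (Bj ν.M₁ (Z i) (k i)) Wd U₀) 0 x = Pi.single i' ξ ∧
            ∑ b, ‖(x b : Matrix (Fin 2) (Fin 2) ℂ)‖ ≤ B₁ i * ‖ξ‖)
    (hsbU : ∀ i (V : GaugeField (F.P Kt) 0 SU2), ‖coeField V - 1‖ ≤ ρ6 i → Node00.SmallBelow (Node00.avOfRecord F 2 Kt) (k i) V)
    (hcurv : ∀ i (𝔹 : DetSet (F.P Kt)) (Wd : MSField (F.P Kt) SU2) (V : GaugeField (F.P Kt) 0 SU2),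
      ‖coeField V - 1‖ ≤ ρ6 i → AgreeOn 𝔹 (avgFamily (Node00.avOfRecord F 2 Kt) V) Wd →
      ∀ w : PBond (F.P Kt) 0 → lieSU (Fin 2), ‖fderiv ℝ (fderiv ℝ (msChart F 2 Kt (k i) 𝔹 Wd V)) 0 w w‖ ≤ M₂ i * ‖w‖ ^ 2)
    -- the near-flat radius's floor on the class threshold (volume-free)
    (hερ6 : ∀ i, 6 * ((((F.P Kt).d - 1 : ℕ)) : ℝ) * (F.P Kt).L * ν.εreg ≤ ρ6 i)
    -- NO letter per guarded base field ∕ minimiser remains here: the (P4)′ socket and the (P5) row are DISCHARGED below from the class through `hHrow` ∕ `hsbU` ∕ `hcurv` (+ ρ7's local count)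
    -- numerics: the positivity constant fits (`γ₀ := 1∕2`: the chart half's level factor `((L^d)^k∕(L²·L²)^k)∕2` at `d = 4`)
    (hγle : ∀ i, γ / (M i) ^ 5 ≤ 1 / 2 / (2 * (3 * (K i : ℝ) ^ 2 + 2 * (K i : ℝ) ^ 4)))
    (hfar : ∀ i (b : PBond (F.P Kt) 0), b.src ∉ maxDomT ν.M₁ (Z i) 1 →
      (⟨blockIter (k i) b.src, b.dir⟩ : PBond (F.P Kt) (k i)) ∉ bondsOf (pts (k i) (Λ i)))
    (hZblk : ∀ i, IsBlockUnion (k i) (Z i))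
    (hM2 : 2 ≤ ν.M₁) (hdiv : ∀ i, side (F.P Kt).L ν.M₁ (k i) ∣ (F.P Kt).sitesPerDir 0)
    {cE B₃ a₀ a₁' cA : ℝ} (hcE0 : 0 ≤ cE) (hcE : ∀ i, 12 * ((F.P Kt).d : ℝ) * ((n i : ℝ) + 2) ^ 2 ≤ cE) (hB₃ : 0 ≤ B₃)
    (heRa : ∀ i, (cE + 1) * eR i ≤ a₁' ∧ B₃ * ((cE + 1) * eR i) ≤ ν.εreg) (ha₀ : ν.εreg ≤ a₀)
    (hcA : 1 / 2 * (B₃ * (cE + 1) * (F.P Kt).eta 1 ^ 2) ^ 2 * (Fintype.card (Plaq (F.P Kt) 0) : ℝ) ≤ cA)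
    (h15T : ∀ (k' : ℕ), k' ≤ (F.P Kt).m + (F.P Kt).K → side (F.P Kt).L ν.M₁ k' ∣ (F.P Kt).sitesPerDir 0 →
      ∀ (s : B14.Eq218Concrete.Seq (fun n : ℕ => Node00.unionsOfCubes (F.P Kt) (side (F.P Kt).L ν.M₁ n)) k'),
      Node00.Sect2.SeqSeparated ν.M₁ s → 0 < ν.M₁ →
      ∀ (ε₀ : ℝ) (δ : ℕ → ℝ), (∀ j, j ≤ k' → 0 < δ j ∧ δ j ≤ a₁' ∧ B₃ * δ j ≤ ε₀) → (∀ j, j < k' → δ j ≤ 2 * δ (j + 1)) →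
      (∀ j, j < k' → δ (j + 1) ≤ 2 * δ j) → ε₀ ≤ a₀ →
      ∀ W : MSField (F.P Kt) SU2,
        Node00.Sect2.DataSmall7PTop (Node00.avOfRecord F 2 Kt) s.Ω (Node00.suppDomOfRecord F ν Kt s.Ω) k' δ W →
        ∀ U₀ : GaugeField (F.P Kt) 0 SU2, IsMinimizer (Node00.avOfRecord F 2 Kt)
            {U | (∀ j, j ≤ k' → PlaqSmallOn (Node00.Sect2.omegaPlaqsTop s.Ω (Node00.suppDomOfRecord F ν Kt s.Ω) j)
                (ε₀ * (F.P Kt).eta j ^ 2) U) ∧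
              Node00.Sect2.CoDivClassOnTop s.Ω (Node00.suppDomOfRecord F ν Kt s.Ω) k' ε₀ U}
            (genSet s.Ω k') W U₀ →
          (∀ j, j ≤ k' → PlaqSmallOn (Node00.Sect2.omegaPlaqsTop s.Ω (Node00.suppDomOfRecord F ν Kt s.Ω) j)
              (B₃ * δ j * (F.P Kt).eta j ^ 2) U₀) ∧
            ∀ j, j ≤ k' → Node00.Sect2.CoDivSmallOn (Node00.Sect2.omegaBondsTop s.Ω (Node00.suppDomOfRecord F ν Kt s.Ω) j)
              (B₃ * δ j * (F.P Kt).eta j ^ 3) U₀)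
    (hcJ' : ∀ i, 2 * cA * eR i / R i + 4 * ((Fintype.card (Plaq (F.P Kt) 0) : ℝ) * (1 + 8 * 𝓐₀ i ^ 4)) / (R i * eR i) ≤ cJ)
    -- THE EXPLICIT-THRESHOLD FRAME (no `∃ δ₀`): tolerances below `Θ i := min (min (ρ i) (ρτ i) ∕ 2) (min 1 (rhs_i ∕ (max S_i 0 + 1)))`, every symbol a binder or a cardinality
    : ∀ δ : ι → ℝ, (∀ i, 0 < δ i) →
      (∀ i, δ i ≤ min (min (min (ρ i) (ρτ i) / 2)
        (min 1 (1 / 2 / (2 * (3 * (K i : ℝ) ^ 2 + 2 * (K i : ℝ) ^ 4)) /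
          (max ((32 * (((F.P Kt).d : ℝ) - 1) + 8 * (((F.P Kt).d : ℝ) - 1) + (2 * (((F.P Kt).d : ℝ) - 1) * B₁ i * (((∑ j ∈ Finset.range (k i + 1), (2 * (F.P Kt).d) ^ j : ℕ) : ℝ) * M₂ i))) * (12 * 𝓐₀ i / R i * Real.sqrt (Nat.card {b : PBond (F.P Kt) 0 // b.src ∈ maxDomT ν.M₁ (Z i) 1})) ^ 2
            + (8 * (((F.P Kt).d : ℝ) + 1) * (2 * (Kτ i + 1)) + 8 * ((F.P Kt).d : ℝ) * (((box (fun κ => (hi i κ - lo i κ + 1).toNat + 3) (fun κ => lo i κ - 2)).image (fun z => (castSite z : Site (F.P Kt) (k i)))).card : ℝ) * (C i * (12 * 𝓐₀ i / R i * Real.sqrt (Nat.card {b : PBond (F.P Kt) 0 // b.src ∈ maxDomT ν.M₁ (Z i) 1}))) ^ 2)) 0 + 1)))) (εH i)) →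
      -- (σ)_W, THE PLAQUETTE LETTER AND THE TOWER-BOX PLAQUETTE LETTER ALL DISCHARGED FROM THE CLASS (dag-n12-w6 g7's k-UNIFORM window-LOCAL producer `hσW_on_uniform_of_class`,
      -- dag-n12-c g21's `hPχ_on_of_class` ∕ `hPbox_on_of_class`, at tolerance `δ i`, `ε := εreg`): the ONLY row left under the threshold is the producer's k-FREE TOLERANCE FLOOR —
      -- `(((4d+m′+3)²L²∕4) + m′·24(((d+2)L)²∕4))·εreg + m′·ρn i ≤ δ i` (with `δ i` below the EXPLICIT threshold above: a checkable smallness condition on the class threshold `εreg` and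
      -- the datum tolerance `ρn i`, uniform in the height `k` — the direct road's displayed price)
      ∀ (hfloor : ∀ i, ((((4 * (F.P Kt).d + (3 * ((F.P Kt).d * (((F.P Kt).L - 1) / 2)) + 5) + 3 : ℕ) : ℝ)) ^ 2 * ((F.P Kt).L : ℝ) ^ 2 / 4 + ((3 * ((F.P Kt).d * (((F.P Kt).L - 1) / 2)) + 5 : ℕ) : ℝ) * (24 * (((((F.P Kt).d + 2) * (F.P Kt).L : ℕ) : ℝ) ^ 2 / 4))) * ν.εreg + ((3 * ((F.P Kt).d * (((F.P Kt).L - 1) / 2)) + 5 : ℕ) : ℝ) * ρn i ≤ δ i),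
      ∃ a₁ : ι → ℝ, (∀ i, 0 < a₁ i) ∧
      B15.Prop1Printed (lfVarOn su2Chart fun i =>
        InstOn.std (Node00.bgMSCoPOfRecord F 2 ν Kt (k i) (maxDomT ν.M₁ (Z i))) ν.M₁ (Z i) (Λ i) (k i) (M i) (a₁ i)
          (anExt (pts (k i) (Λ i)) (T i)
            (fun177std (Node00.bgMSCoPOfRecord F 2 ν Kt (k i) (maxDomT ν.M₁ (Z i))) ν.M₁ (Z i) (k i)) (ext i)
            (min (1 / 2) (min (R i / 8) (γ / (M i) ^ 5 * (R i / 2) ^ 2 /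
              (48 * (4 * ((Fintype.card (Plaq (F.P Kt) 0) : ℝ) * (1 + 8 * 𝓐₀ i ^ 4)) / R i + 1))))))) := by
  have hk : ∀ i, k i ≤ (F.P Kt).m + (F.P Kt).K := fun i => Nat.le_of_succ_le (hk1 i)
  have hρn0 : ∀ i, 0 ≤ ρn i := fun i => le_trans (by have := heR i; positivity) (hρn i)
  have hrad : (F.P Kt).L + ((F.P Kt).L - 1) / 2 ≤ ν.M₁ := by have := hM4; omega
  intro δ hδpos hδle hfloor
  -- the class letters' tolerance condition `εreg ≤ δ i` from the floor (its `εreg`-coefficient is `≥ 1`)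
  have hδε : ∀ i, ν.εreg ≤ δ i := fun i => by
    have hm : (0 : ℝ) ≤ ((3 * ((F.P Kt).d * (((F.P Kt).L - 1) / 2)) + 5 : ℕ) : ℝ) * ρn i := mul_nonneg (Nat.cast_nonneg _) (hρn0 i)
    have h8 : (8 : ℝ) ≤ (((4 * (F.P Kt).d + (3 * ((F.P Kt).d * (((F.P Kt).L - 1) / 2)) + 5) + 3 : ℕ) : ℝ)) := by
      have h : 8 ≤ 4 * (F.P Kt).d + (3 * ((F.P Kt).d * (((F.P Kt).L - 1) / 2)) + 5) + 3 := by omega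
      exact_mod_cast h
    have hL1 : (1 : ℝ) ≤ ((F.P Kt).L : ℝ) := by exact_mod_cast Nat.succ_le_of_lt (F.P Kt).L_pos
    have hB : (0 : ℝ) ≤ ((3 * ((F.P Kt).d * (((F.P Kt).L - 1) / 2)) + 5 : ℕ) : ℝ) * (24 * (((((F.P Kt).d + 2) * (F.P Kt).L : ℕ) : ℝ) ^ 2 / 4)) := by positivity
    have hAL : (8 : ℝ) * 1 ≤ (((4 * (F.P Kt).d + (3 * ((F.P Kt).d * (((F.P Kt).L - 1) / 2)) + 5) + 3 : ℕ) : ℝ)) * ((F.P Kt).L : ℝ) := mul_le_mul h8 hL1 zero_le_one (by positivity)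
    have h64 : (8 : ℝ) * 1 * (8 * 1) ≤ (((4 * (F.P Kt).d + (3 * ((F.P Kt).d * (((F.P Kt).L - 1) / 2)) + 5) + 3 : ℕ) : ℝ)) * ((F.P Kt).L : ℝ) * ((((4 * (F.P Kt).d + (3 * ((F.P Kt).d * (((F.P Kt).L - 1) / 2)) + 5) + 3 : ℕ) : ℝ)) * ((F.P Kt).L : ℝ)) :=
      mul_le_mul hAL hAL (by norm_num) (by positivity)
    have hC : (1 : ℝ) ≤ (((4 * (F.P Kt).d + (3 * ((F.P Kt).d * (((F.P Kt).L - 1) / 2)) + 5) + 3 : ℕ) : ℝ)) ^ 2 * ((F.P Kt).L : ℝ) ^ 2 / 4 + ((3 * ((F.P Kt).d * (((F.P Kt).L - 1) / 2)) + 5 : ℕ) : ℝ) * (24 * (((((F.P Kt).d + 2) * (F.P Kt).L : ℕ) : ℝ) ^ 2 / 4)) := by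
      nlinarith [h64, hB]
    have h1 := le_mul_of_one_le_left hεreg.le hC
    linarith [hfloor i, hm, h1]
  -- (D1)⁵ with the three letters fed by their class producers at `δc = δW := δ i`
  exact exists_domain_prop1Printed_lfVarOn_std_su2_box_intrinsic_analytic_atZSeqCoPRecord_ofThm1TorusClass_ofMinimiserFamily_ofWindowGaugeLetter_ofClassOnlyRowL1_explicit
    ν Kt hd3 h0 Z Λ k M hk0 hk1 eR heR T lo hi n hn hN hbox hZ hTG0 hN5 K hK1 hKn ext hext hlohi LO HI hLO hHI n' hn' hn'N hR' ρn hρn hγ hcJ hbx hbxM hM hR h𝓐₀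
    hMin hΩw W hWbox C ρ Kτ ρτ ρ5 hρ hKτ hρτ hhalf hM4 hεreg hερ εH B₁ M₂ ρ6 hB1 hM₂0 hHrow hsbU hcurv hερ6 hγle hfar hZblk hM2 hdiv hcE0 hcE hB₃ heRa ha₀ hcA h15T
    hcJ'
    δ hδpos hδle
    (hσW_on_uniform_of_class ν Kt h0 Z Λ k hk0 hk eR lo hi ext LO HI ρn hρn0 hdiv c hkc hc W hεreg hα3 hα2 haN X D₀ hXΩ hfit hBox hWX hfeedsX hfloor hfloor)
    (hPχ_on_of_class ν Kt Z Λ k hk0 eR ext LO HI ρn hεreg.le δ hδε) (hPbox_on_of_class ν Kt Z Λ k eR ext LO HI ρn hM2 hrad hdiv hεreg.le δ hδε)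

end Summit.QuantumFields.YangMills.BalabanUVNodes.N12Prop1DirectOfClassOnlyRowL1WindowUniform

end
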